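import Summits.KontsevichZagierPeriods.KontsevichZagierPeriods.Theorems.MzvKernelInKZ.Negative.CubicalChart

/-!
# `MzvKernelInKZ` (stmt-KontsevichZagierPeriods-3914): negative side — the stuffle `ζ(2)² = 2ζ(2,2) + ζ(4)` is a move chain

Companion of `Negative/CubicalChart.lean`.  **THE STUFFLE AT WEIGHT 4 IS A KZ MOVE CHAIN with
absolutely convergent rational intermediates** (`cStuffle4_mem_relations`):
`[Δ₂×Δ₂, ω₀₁⊗ω₀₁] − [Δ₄, 2ω₀₁₀₁] − [Δ₄, ω₀₀₀₁] ∈ KZ.relations`.  The chain: the product chart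
`x ↦ (x₀, x₀x₁, x₂, x₂x₃)` (`(0,1)⁴ → Δ₂ × Δ₂`, Jacobian `x₀x₂`; one move (2),
`Cprod_sub_P22_mem_changeOfVariablesRel`, the integrand of the product representation being
`ω₀₁ ⊗ ω₀₁` by the discharged Tarski–Seidenberg branch `IntegralRep.prod_integrand_eq`) turns
`ζ(2)²` into `[□⁴, 1/((1−ab)(1−cd))]`; Soudères' partial fractions
`1/((1−ab)(1−cd)) = 1/(1−abcd) + ab/((1−ab)(1−abcd)) + cd/((1−cd)(1−abcd))` are TWO
integrand-additivity moves (1b) with positive convergent terms (`Cprod_sub_Csum_sub_C22r_mem`,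
`Csum_sub_C4_sub_C22_mem`); the block swap `(a,b,c,d) ↦ (c,d,a,b)` is a coordinate permutation
(`C22_sub_C22r_mem`, rule (2)); the two cube representations go back to `Δ₄` by the cubical chart
(`CubicalChart.lean`); coefficients are merged by integrand additivity (`of_wordRep_add`).  This is
the `s = t = (2)` instance of the stuffle family (crux `StuffleInKZ` of route FurushoPentagon,
stmt-3931) in the generator shape of the present crux.

Sources: I. Soudères, *Motivic double shuffle*, Int. J. Number Theory 6 (2010), Prop. 1.5;
M. Kontsevich, D. Zagier, *Periods* (2001), §1.2 rules (1b), (2); M. E. Hoffman, *The algebra of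
multiple harmonic series*, J. Algebra 194 (1997), §2.
-/

noncomputable section

namespace Summit.KontsevichZagierPeriods.MzvKernelInKZ.Negative

open Set MeasureTheory MvPolynomial
open Literature.NumberTheory.Transcendental
open Summit.KontsevichZagierPeriods.KontsevichZagierPeriods.Theses.LinRedNormalForm (MzvKernelInKZ)
open Literature.ModelTheory.ExponentialFields (IsSemialgebraic)

/-! ## The product chart `x ↦ (x₀, x₀x₁, x₂, x₂x₃)` : `□⁴ → Δ₂ × Δ₂` -/

/-- The product of the cubical charts of two `Δ₂`'s. [folklore] -/
def prodMap (x : Fin 4 → ℝ) : Fin 4 → ℝ := ![x 0, x 0 * x 1, x 2, x 2 * x 3]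

/-- First coordinate of the product chart. [folklore] -/
@[simp] theorem prodMap_zero (x : Fin 4 → ℝ) : prodMap x 0 = x 0 := rfl
/-- Second coordinate of the product chart. [folklore] -/
@[simp] theorem prodMap_one (x : Fin 4 → ℝ) : prodMap x 1 = x 0 * x 1 := rfl
/-- Third coordinate of the product chart. [folklore] -/
@[simp] theorem prodMap_two (x : Fin 4 → ℝ) : prodMap x 2 = x 2 := rfl
/-- Fourth coordinate of the product chart. [folklore] -/
@[simp] theorem prodMap_three (x : Fin 4 → ℝ) : prodMap x 3 = x 2 * x 3 := rfl

/-- Its Jacobian matrix. [folklore] -/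
def prodJac (x : Fin 4 → ℝ) : Matrix (Fin 4) (Fin 4) ℝ :=
  !![1, 0, 0, 0;
     x 1, x 0, 0, 0;
     0, 0, 1, 0;
     0, 0, x 3, x 2]

/-- Its derivative. [folklore] -/
def prodDeriv (x : Fin 4 → ℝ) : (Fin 4 → ℝ) →L[ℝ] (Fin 4 → ℝ) :=
  LinearMap.toContinuousLinearMap (Matrix.toLin' (prodJac x))

/-- The derivative acts by the Jacobian matrix. [folklore] -/
theorem prodDeriv_apply (x v : Fin 4 → ℝ) : prodDeriv x v = (prodJac x).mulVec v := rfl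

/-- `det J = x₀x₂`. [folklore] -/
theorem det_prodJac (x : Fin 4 → ℝ) : (prodJac x).det = x 0 * x 2 := by
  simp [prodJac, Matrix.det_succ_row_zero, Fin.sum_univ_succ]

/-- The Jacobian determinant of the product chart is `x₀x₂`. [folklore] -/
theorem det_prodDeriv (x : Fin 4 → ℝ) : (prodDeriv x).det = x 0 * x 2 := by
  rw [← det_prodJac]
  exact LinearMap.det_toLin' _

/-- The product chart is differentiable with derivative `prodDeriv`. [folklore] -/
theorem hasFDerivAt_prodMap (x : Fin 4 → ℝ) : HasFDerivAt prodMap (prodDeriv x) x := by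
  have h0 := hasFDerivAt_coord 0 x
  have h1 := hasFDerivAt_coord 1 x
  have h2 := hasFDerivAt_coord 2 x
  have h3 := hasFDerivAt_coord 3 x
  have c0 : HasFDerivAt (fun y : Fin 4 → ℝ => prodMap y 0)
      ((ContinuousLinearMap.proj 0).comp (prodDeriv x)) x := by
    refine h0.congr_fderiv ?_
    ext v
    simp [prodDeriv_apply, prodJac, dotProduct, Fin.sum_univ_four]
  have c1 : HasFDerivAt (fun y : Fin 4 → ℝ => prodMap y 1)
      ((ContinuousLinearMap.proj 1).comp (prodDeriv x)) x := by
    refine (h0.mul h1).congr_fderiv ?_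
    ext v
    simp [prodDeriv_apply, prodJac, dotProduct, Fin.sum_univ_four]
    ring
  have c2 : HasFDerivAt (fun y : Fin 4 → ℝ => prodMap y 2)
      ((ContinuousLinearMap.proj 2).comp (prodDeriv x)) x := by
    refine h2.congr_fderiv ?_
    ext v
    simp [prodDeriv_apply, prodJac, dotProduct, Fin.sum_univ_four]
  have c3 : HasFDerivAt (fun y : Fin 4 → ℝ => prodMap y 3)
      ((ContinuousLinearMap.proj 3).comp (prodDeriv x)) x := by
    refine (h2.mul h3).congr_fderiv ?_
    ext v
    simp [prodDeriv_apply, prodJac, dotProduct, Fin.sum_univ_four]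
    ring
  rw [hasFDerivAt_pi']
  intro i
  fin_cases i
  · exact c0
  · exact c1
  · exact c2
  · exact c3

/-- The product chart is injective on the open cube. [folklore] -/
theorem injOn_prodMap : InjOn prodMap cube4 := by
  intro x hx y hy h
  rw [mem_cube4] at hx hy
  have e0 : x 0 = y 0 := by simpa using congrFun h 0
  have e1' : x 0 * x 1 = y 0 * y 1 := by simpa using congrFun h 1
  have e2 : x 2 = y 2 := by simpa using congrFun h 2
  have e3' : x 2 * x 3 = y 2 * y 3 := by simpa using congrFun h 3
  have e1 : x 1 = y 1 := by
    rw [e0] at e1'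
    exact mul_left_cancel₀ (hy 0).1.ne' e1'
  have e3 : x 3 = y 3 := by
    rw [e2] at e3'
    exact mul_left_cancel₀ (hy 2).1.ne' e3'
  funext i
  fin_cases i <;> assumption

/-- Membership in `Δ₂`, coordinatewise. [folklore] -/
theorem mem_simplex_two {t : Fin 2 → ℝ} :
    t ∈ simplex 2 ↔ 0 < t 0 ∧ 0 < t 1 ∧ t 0 < 1 ∧ t 1 < 1 ∧ t 1 < t 0 := by
  simp only [simplex, mem_setOf_eq, Fin.forall_fin_two, Fin.strictAnti_iff_succ_lt,
    Fin.forall_fin_one]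
  constructor
  · rintro ⟨⟨a, b⟩, ⟨c, d⟩, e⟩
    exact ⟨a, b, c, d, by simpa using e⟩
  · rintro ⟨a, b, c, d, e⟩
    exact ⟨⟨a, b⟩, ⟨c, d⟩, by simpa using e⟩

/-- The product representation `[Δ₂ × Δ₂, ω₀₁ ⊗ ω₀₁]` of `ζ(2)·ζ(2)`. [folklore] -/
def P22 : KZ.IntegralRep 4 := (wordRep ω2 1 adm_ω2).prod (wordRep ω2 1 adm_ω2)

/-- The domain of `P22` is the product domain `Δ₂ × Δ₂`. [folklore] -/
theorem P22_domain : P22.domain =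
    KZ.IntegralRep.prodDomain (wordRep ω2 1 adm_ω2) (wordRep ω2 1 adm_ω2) := rfl

/-- The integrand of `P22` is `ω₀₁ ⊗ ω₀₁` (Tarski–Seidenberg branch of `IntegralRep.prod`). [folklore] -/
theorem P22_integrand : P22.integrand =
    KZ.IntegralRep.prodFun (wordRep ω2 1 adm_ω2) (wordRep ω2 1 adm_ω2) :=
  KZ.IntegralRep.prod_integrand_eq _ _

/-- Membership in `Δ₂ × Δ₂`, coordinatewise. [folklore] -/
theorem mem_P22_domain {z : Fin 4 → ℝ} :
    z ∈ P22.domain ↔ (0 < z 0 ∧ 0 < z 1 ∧ z 0 < 1 ∧ z 1 < 1 ∧ z 1 < z 0) ∧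
      (0 < z 2 ∧ 0 < z 3 ∧ z 2 < 1 ∧ z 3 < 1 ∧ z 3 < z 2) := by
  rw [P22_domain, KZ.IntegralRep.mem_prodDomain, wordRep_domain, mem_simplex_two, mem_simplex_two]
  simp [Fin.natAdd, Fin.castAdd]

/-- The integrand of `P22`, unfolded: `1/(z₀(1−z₁)) · 1/(z₂(1−z₃))`. [folklore] -/
theorem P22_integrand_apply (z : Fin 4 → ℝ) :
    P22.integrand z = 1 / z 0 * (1 / (1 - z 1)) * (1 / z 2 * (1 / (1 - z 3))) := by
  rw [P22_integrand, KZ.IntegralRep.prodFun_apply, wordRep_integrand, wordFun_ω2, wordFun_ω2]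
  simp [Fin.natAdd, Fin.castAdd]

/-- The product chart maps the open cube into `Δ₂ × Δ₂`. [folklore] -/
theorem prodMap_mem_P22_domain {x : Fin 4 → ℝ} (hx : x ∈ cube4) : prodMap x ∈ P22.domain := by
  obtain ⟨h0, h1, h2, h3, h0', h1', h2', h3', p01, p23, -⟩ := cube_facts hx
  rw [mem_P22_domain]
  simp only [prodMap_zero, prodMap_one, prodMap_two, prodMap_three]
  exact ⟨⟨h0, mul_pos h0 h1, h0', p01, mul_lt_of_lt_one_right h0 h1'⟩,
    ⟨h2, mul_pos h2 h3, h2', p23, mul_lt_of_lt_one_right h2 h3'⟩⟩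

/-- The inverse of the product chart. [folklore] -/
def prodInv (z : Fin 4 → ℝ) : Fin 4 → ℝ := ![z 0, z 1 / z 0, z 2, z 3 / z 2]

/-- `prodMap ∘ prodInv = id` on `Δ₂ × Δ₂`. [folklore] -/
theorem prodMap_prodInv {z : Fin 4 → ℝ} (hz : z ∈ P22.domain) : prodMap (prodInv z) = z := by
  rw [mem_P22_domain] at hz
  have z0 := hz.1.1.ne'; have z2 := hz.2.1.ne'
  funext i
  fin_cases i <;> simp [prodMap, prodInv] <;> field_simp

/-- The inverse product chart maps `Δ₂ × Δ₂` into the open cube. [folklore] -/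
theorem prodInv_mem_cube {z : Fin 4 → ℝ} (hz : z ∈ P22.domain) : prodInv z ∈ cube4 := by
  rw [mem_P22_domain] at hz
  obtain ⟨⟨a0, a1, a0', -, a10⟩, ⟨b0, b1, b0', -, b10⟩⟩ := hz
  rw [mem_cube4]
  intro i
  fin_cases i
  · simpa [prodInv] using ⟨a0, a0'⟩
  · simp only [prodInv]
    exact ⟨by simpa using div_pos a1 a0, by simpa using (div_lt_one a0).mpr a10⟩
  · simpa [prodInv] using ⟨b0, b0'⟩
  · simp only [prodInv]
    exact ⟨by simpa using div_pos b1 b0, by simpa using (div_lt_one b0).mpr b10⟩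

/-- **The product chart maps `(0,1)⁴` ONTO `Δ₂ × Δ₂`.** [folklore] -/
theorem image_prodMap : prodMap '' cube4 = P22.domain := by
  apply Subset.antisymm
  · rintro _ ⟨x, hx, rfl⟩
    exact prodMap_mem_P22_domain hx
  · intro z hz
    exact ⟨prodInv z, prodInv_mem_cube hz, prodMap_prodInv hz⟩

/-- The product chart is a polynomial map over `ℚ`, hence `ℚ`-semialgebraic on the cube. [folklore] -/
theorem isSemialgebraicMapOn_prodMap : IsSemialgebraicMapOn ℚ cube4 prodMap := by
  have h := isSemialgebraicMapOn_aeval (isSemialgebraic_openUnitCube (d := 4))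
    (![X 0, X 0 * X 1, X 2, X 2 * X 3] : Fin 4 → MvPolynomial (Fin 4) ℚ)
  refine h.congr fun x _ => ?_
  funext j
  fin_cases j <;> simp [prodMap]

/-- PULLBACK IDENTITY for the product. [folklore] -/
theorem fprod_eq {x : Fin 4 → ℝ} (hx : x ∈ cube4) :
    fprod x = P22.integrand (prodMap x) * |(prodDeriv x).det| := by
  obtain ⟨h0, h1, h2, h3, -, -, -, -, p01, p23, -⟩ := cube_facts hx
  rw [det_prodDeriv, abs_of_pos (by positivity), P22_integrand_apply]
  simp only [prodMap_zero, prodMap_one, prodMap_two, prodMap_three, fprod]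
  have : (1 : ℝ) - x 0 * x 1 ≠ 0 := by linarith
  have : (1 : ℝ) - x 2 * x 3 ≠ 0 := by linarith
  field_simp

/-- Integrability of the product cube integrand, transported from `Δ₂ × Δ₂` through the chart. [folklore] -/
theorem integrableOn_fprod : IntegrableOn fprod cube4 volume := by
  have hP : IntegrableOn P22.integrand (prodMap '' cube4) volume := by
    rw [image_prodMap]; exact P22.integrableOn
  have h := (integrableOn_image_iff_integrableOn_abs_det_fderiv_smul volume measurableSet_cube4
    (fun x _ => (hasFDerivAt_prodMap x).hasFDerivWithinAt) injOn_prodMap P22.integrand).mp hP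
  refine h.congr_fun (fun x hx => ?_) measurableSet_cube4
  dsimp only
  rw [smul_eq_mul, mul_comm, ← fprod_eq hx]

/-- The cube representation of `ζ(2)²`. [folklore] -/
def Cprod : KZ.IntegralRep 4 :=
  ⟨cube4, fprod, isSemialgebraic_openUnitCube, isSemialgebraicFunOn_fprod, integrableOn_fprod⟩

/-- **`[□⁴, 1/((1−ab)(1−cd))] − [Δ₂ × Δ₂, ω₀₁ ⊗ ω₀₁]` is ONE change-of-variables move.** [folklore] -/
theorem Cprod_sub_P22_mem_changeOfVariablesRel :
    KZ.of Cprod - KZ.of P22 ∈ KZ.changeOfVariablesRel :=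
  ⟨4, Cprod, P22, prodMap, fun x => prodDeriv x, isSemialgebraicMapOn_prodMap,
    fun x _ => (hasFDerivAt_prodMap x).hasFDerivWithinAt, injOn_prodMap, image_prodMap.symm,
    fun _ hx => fprod_eq hx, rfl⟩

/-! ## Soudères' partial fractions on the cube: two integrand-additivity moves -/

/-- The block swap `(a,b,c,d) ↦ (c,d,a,b)` of the coordinates. [folklore] -/
def blockSwap : Equiv.Perm (Fin 4) := Equiv.swap 0 2 * Equiv.swap 1 3

/-- `blockSwap 0 = 2`. [folklore] -/
@[simp] theorem blockSwap_zero : blockSwap 0 = 2 := by decide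
/-- `blockSwap 1 = 3`. [folklore] -/
@[simp] theorem blockSwap_one : blockSwap 1 = 3 := by decide
/-- `blockSwap 2 = 0`. [folklore] -/
@[simp] theorem blockSwap_two : blockSwap 2 = 0 := by decide
/-- `blockSwap 3 = 1`. [folklore] -/
@[simp] theorem blockSwap_three : blockSwap 3 = 1 := by decide

/-- `[□⁴, cd/((1−cd)(1−abcd))]`: the `ζ(2,2)` cube representation with the blocks swapped. [folklore] -/
def C22r : KZ.IntegralRep 4 := C22.reindex blockSwap

/-- The block-swapped representation still lives on the cube. [folklore] -/
theorem C22r_domain : C22r.domain = cube4 := by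
  ext w
  simp only [C22r, KZ.IntegralRep.reindex_domain, mem_setOf_eq]
  change (fun i => w (blockSwap i)) ∈ cube4 ↔ w ∈ cube4
  rw [mem_cube4, mem_cube4]
  constructor
  · intro h i
    fin_cases i
    · simpa using h 2
    · simpa using h 3
    · simpa using h 0
    · simpa using h 1
  · intro h i
    fin_cases i
    · simpa using h 2
    · simpa using h 3
    · simpa using h 0
    · simpa using h 1

/-- The block-swapped integrand: `cd/((1−cd)(1−cdab))`. [folklore] -/
theorem C22r_integrand_apply (w : Fin 4 → ℝ) :
    C22r.integrand w = w 2 * w 3 / ((1 - w 2 * w 3) * (1 - w 2 * w 3 * w 0 * w 1)) := by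
  simp [C22r, C22, f22]

/-- `[□⁴, 1/(1−abcd) + ab/((1−ab)(1−abcd))]` (the sum of the `ζ(4)` and `ζ(2,2)` integrands). [folklore] -/
def Csum : KZ.IntegralRep 4 :=
  ⟨cube4, f4 + f22, isSemialgebraic_openUnitCube,
    IsSemialgebraicFunOn.add_holds isSemialgebraicFunOn_f4 isSemialgebraicFunOn_f22,
    integrableOn_f4.add integrableOn_f22⟩

/-- **Soudères' identity, first half**: `1/((1−ab)(1−cd)) = [1/(1−abcd) + ab/((1−ab)(1−abcd))] +
cd/((1−cd)(1−abcd))` on the cube — ONE integrand-additivity move. [folklore] -/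
theorem Cprod_sub_Csum_sub_C22r_mem : KZ.of Cprod - KZ.of Csum - KZ.of C22r ∈ KZ.integrandAddRel := by
  refine ⟨4, Cprod, Csum, C22r, rfl, C22r_domain, fun x hx => ?_, rfl⟩
  obtain ⟨h0, h1, h2, h3, -, -, -, -, p01, p23, p⟩ := cube_facts hx
  have e1 : (1 : ℝ) - x 0 * x 1 ≠ 0 := by linarith
  have e2 : (1 : ℝ) - x 2 * x 3 ≠ 0 := by linarith
  have e3 : (1 : ℝ) - x 0 * x 1 * x 2 * x 3 ≠ 0 := by linarith
  have e4 : (1 : ℝ) - x 2 * x 3 * x 0 * x 1 ≠ 0 := by linarith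
  change fprod x = (f4 x + f22 x) + C22r.integrand x
  rw [C22r_integrand_apply]
  simp only [fprod, f4, f22]
  field_simp
  ring

/-- **Second half**: `1/(1−abcd) + ab/((1−ab)(1−abcd))` splits — ONE integrand-additivity move. [folklore] -/
theorem Csum_sub_C4_sub_C22_mem : KZ.of Csum - KZ.of C4 - KZ.of C22 ∈ KZ.integrandAddRel :=
  ⟨4, Csum, C4, C22, rfl, rfl, fun _ _ => rfl, rfl⟩

/-- The block swap is a coordinate permutation, hence a relation. [folklore] -/
theorem C22_sub_C22r_mem : KZ.of C22 - KZ.of C22r ∈ KZ.relations :=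
  KZ.of_sub_of_reindex_mem_relations C22 blockSwap

/-! ## Assembly: the stuffle `ζ(2)² = 2ζ(2,2) + ζ(4)` as a move chain -/

/-- The stuffle element `[Δ₂×Δ₂, ω₀₁⊗ω₀₁] − [Δ₄, 2ω₀₁₀₁] − [Δ₄, ω₀₀₀₁]`. [folklore] -/
def cStuffle4 : KZ.FormalRep :=
  KZ.of P22 - KZ.of (wordRep ω22 2 adm_ω22) - KZ.of (wordRep ω4 1 adm_ω4)

/-- **THE STUFFLE AT WEIGHT 4 IS A MOVE CHAIN** with absolutely convergent rational intermediates
(three changes of variables, two integrand additivities, one coordinate permutation, bookkeeping):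
`cStuffle4 ∈ KZ.relations`. [folklore] -/
theorem cStuffle4_mem_relations : cStuffle4 ∈ KZ.relations := by
  have h1 := KZ.changeOfVariablesRel_subset_relations Cprod_sub_P22_mem_changeOfVariablesRel
  have h2 := KZ.integrandAddRel_subset_relations Cprod_sub_Csum_sub_C22r_mem
  have h3 := KZ.integrandAddRel_subset_relations Csum_sub_C4_sub_C22_mem
  have h4 := C22_sub_C22r_mem
  have h5 := KZ.changeOfVariablesRel_subset_relations C4_sub_mem_changeOfVariablesRel
  have h6 := KZ.changeOfVariablesRel_subset_relations C22_sub_mem_changeOfVariablesRel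
  have h7 := of_wordRep_add ω22 1 1 adm_ω22
  norm_num at h7
  have : cStuffle4 = -(KZ.of Cprod - KZ.of P22) + (KZ.of Cprod - KZ.of Csum - KZ.of C22r)
      + (KZ.of Csum - KZ.of C4 - KZ.of C22) - (KZ.of C22 - KZ.of C22r)
      + (KZ.of C4 - KZ.of (wordRep ω4 1 adm_ω4))
      + (KZ.of C22 - KZ.of (wordRep ω22 1 adm_ω22)) + (KZ.of C22 - KZ.of (wordRep ω22 1 adm_ω22))
      - (KZ.of (wordRep ω22 2 adm_ω22) - KZ.of (wordRep ω22 1 adm_ω22)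
          - KZ.of (wordRep ω22 1 adm_ω22)) := by
    simp only [cStuffle4]; abel
  rw [this]
  refine sub_mem (add_mem (add_mem (add_mem (sub_mem (add_mem (add_mem (neg_mem h1) h2) h3) h4)
    h5) h6) h6) h7

end Summit.KontsevichZagierPeriods.MzvKernelInKZ.Negative
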